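import Mathlib.LinearAlgebra.SesquilinearForm.Basic
import Mathlib.LinearAlgebra.PerfectPairing.Basic
import Mathlib.LinearAlgebra.Projection
import Mathlib.LinearAlgebra.Span.Basic
import Mathlib.LinearAlgebra.Basis.Defs
import HarnessLib

/-!
# A split line pairs onto the ring under a left-surjective alternating pairing

Topic `LinearAlgebra/Alternating`; theorems only (no definition, no named fact), sorry-free, over an arbitrary
commutative ring.

The elementary fact: let `B : M × M → R` be an ALTERNATING bilinear pairing whose left map `M → M^∨`,
`m ↦ B(m, −)`, is SURJECTIVE (e.g. a perfect pairing), and let `M = L + R·ω` with `ω` unimodular (some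
functional takes the value `1` on `ω`; e.g. `M = L ⊕ Rω` with `ω` free). Then `B(ω, L) = R`: some `t ∈ L` has
`B(ω, t) = 1` (`exists_mem_apply_eq_one_of_isAlt`; corollaries `map_eq_top_of_isAlt`, the rank-two basis form
`isUnit_apply_basis_of_isAlt` — "the off-diagonal Gram entry of an alternating form with surjective left map on a
free module of rank `2` is a unit", i.e. the module is a hyperbolic plane —, and the `IsPerfPair` forms). The proof
is three lines: hit a functional `φ` with `φ(ω) = 1` by `B(v, −)`, write `v = l + rω`, and use `B(ω, ω) = 0`:
`1 = φ(ω) = B(l, ω) + r·B(ω, ω) = B(l, ω) = −B(ω, l)`. Neither `L ∩ Rω = 0`, nor freeness of `M`, nor any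
finiteness is needed. The section `Splitting` supplies the usual source of such a decomposition: for
`0 → A → D → C → 0` exact and a submodule `F ≤ D` meeting `im A` trivially and mapping ONTO `C`, `D = im A ⊕ F`
(`isCompl_range_of_exact`) and `F → C` is bijective (`bijective_domRestrict_of_exact`); with `F = Rω`, `ω` free,
this gives the functional (`exists_dual_apply_eq_one_of_isCompl`) and the assembled statement
`exists_mem_range_apply_eq_one_of_exact_of_isAlt`.

## Why this file (application; documentary, nothing here depends on it)

This is the ALGEBRAIC SKELETON of the `bsd-litref` cell's «Lemma W» (reader 1, `pub/bsd-litref/cgs25/sheets/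
D-AUDIT-cgs25-r1-ADDENDUM-2.md` sha16 4b747cb084e66906, §F, steps F.4–F.5), the in-cell repair of the
printed-unproved sentence of Burungale–Skinner–Tian–Wan, arXiv:2409.01350v2 (PREPRINT), Part I, TeX l.4175–4176 —
«The restriction [of `ω_{g,α} = [ω_g, −]`] to `D(T⁺)` is mapped isomorphically onto `𝒪_λ`» — for an Eisenstein
newform `g = f_E` (the case `(irr_ℚ)` fails), admitted as a cell repair by referee C4 (ROUND C4-R3-ADD (c), ROUND
C4-R5.3 (1): «PASS-in-cell WITH READER REPAIRS», the steps F.2–F.6 desk-checked by hand at C4-R5.2 (a)). In that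
application `R = ℤ_p`; `0 → A → D → C → 0` is Fontaine–Laffaille's `D_λ` applied to `0 → T⁺ → T → T⁻ → 0`
(`T = H¹_ét(E•, ℤ_p)`, exact with strict maps); `F = Fil¹ D_λ(T) = ℤ_p·ω_{E•}` meets `D(T⁺)` trivially
(`Fil¹ D_λ(T⁺) = 0`) and maps onto `D_λ(T⁻)` (`Fil¹ D_λ(T⁻) = D_λ(T⁻)`) — F.4: «𝔻 = D(T⁺) ⊕ ℤ_p ω_{E•}»;
`B = D(e_{E•})` is the Dieudonné realisation of the Weil/cup-product pairing, PERFECT and ALTERNATING on the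
rank-`2` module `𝔻` — F.5: «isotropy ⇒ D(e_{E•})(ω_{E•}, D(T⁺)) = D(e)(ω_{E•}, 𝔻) = ℤ_p». The theorems below
are exactly the module-theoretic content of those two steps; the COMPARISON inputs that identify the objects
(Fontaine–Laffaille exactness and ⊗-compatibility for `p ≥ 5`, Berthelot–Breen–Messing duality at `p = 3`, the
reading of BSTW's (CanPai), the constants of F.2/F.3/F.6) stay on paper exactly as the referee weighed them
(C4-R5.2 (a), C4-R5.3 (1)); nothing here is a statement about elliptic curves, and no cell of the census moves.
Companions in the same spirit (kernel forms of admitted reader repairs of the same preprint):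
`NumberTheory/EllipticCurves/IwasawaSaturationCriterion.lean` (Lemma S), `…/IwasawaSaturationCongruenceCriterion.lean`
(Lemma C).

What is NOT here: Dieudonné modules, Fontaine–Laffaille theory, any comparison isomorphism, the classification of
alternating forms (see `DarbouxBasis.lean` in this directory for Darboux' theorem over a field).

## References

* S. Lang, *Algebra*, GTM 211 (2002), Ch. XV §8 (alternating forms; hyperbolic planes) — the field case.
* Burungale–Skinner–Tian–Wan, arXiv:2409.01350v2, Part I, l.4174–4176 (the sentence repaired), Rem. 2.7
  (l.1468–1476) [PREPRINT; application only].
-/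

namespace Literature.LinearAlgebra.Alternating

open Function Submodule

section Splitting

variable {R : Type*} [CommRing R]
variable {A D C : Type*} [AddCommGroup A] [Module R A] [AddCommGroup D] [Module R D]
  [AddCommGroup C] [Module R C]

/-- **Splitting from an exact sequence and a transversal submodule onto the quotient.** If
`A —i→ D —q→ C` is exact at `D`, and `F ≤ D` satisfies `im i ∩ F = 0` and `q(F) = C`, then `D = im i ⊕ F`
(as an `IsCompl` of submodules). In «Lemma W» (F.4): `D_λ` of `0 → T⁺ → T → T⁻ → 0` with `F = Fil¹ D_λ(T)`,
`Fil¹ D_λ(T⁺) = 0`, `Fil¹ D_λ(T⁻) = D_λ(T⁻)` gives `𝔻 = D(T⁺) ⊕ Fil¹𝔻`. [cite: BurungaleSkinnerTianWan2024, Part I §5.3.2, TeX l.4174–4176 (the sentence «The restriction to D(T⁺) is mapped isomorphically onto 𝒪_λ» defining ω_{g,α} before (omega-g-eq)) — module-theoretic step F.4 of the in-cell reader repair «Lemma W» (D-AUDIT-cgs25-r1-ADDENDUM-2 §F) only; PREPRINT] -/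
theorem isCompl_range_of_exact (i : A →ₗ[R] D) (q : D →ₗ[R] C) (hex : Function.Exact i q)
    (F : Submodule R D) (hdisj : Disjoint (LinearMap.range i) F) (hF : F.map q = ⊤) :
    IsCompl (LinearMap.range i) F := by
  refine ⟨hdisj, ?_⟩
  rw [codisjoint_iff, Submodule.eq_top_iff']
  intro d
  have hq : q d ∈ F.map q := hF ▸ Submodule.mem_top
  obtain ⟨f, hf, hqf⟩ := Submodule.mem_map.mp hq
  have hker : d - f ∈ LinearMap.range i := by
    have h0 : q (d - f) = 0 := by rw [map_sub, hqf, sub_self]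
    obtain ⟨a, ha⟩ := (hex (d - f)).mp h0
    exact ⟨a, ha⟩
  exact Submodule.mem_sup.mpr ⟨d - f, hker, f, hf, sub_add_cancel d f⟩

/-- Under the same hypotheses `q` restricts to a bijection `F → C` (in «Lemma W» F.4:
`Fil¹𝔻 ⥲ D_λ(T⁻)`). [cite: BurungaleSkinnerTianWan2024, Part I §5.3.2, TeX l.4174–4176 (the sentence «The restriction to D(T⁺) is mapped isomorphically onto 𝒪_λ» defining ω_{g,α} before (omega-g-eq)) — module-theoretic step F.4 of the in-cell reader repair «Lemma W» (D-AUDIT-cgs25-r1-ADDENDUM-2 §F) only; PREPRINT] -/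
theorem bijective_domRestrict_of_exact (i : A →ₗ[R] D) (q : D →ₗ[R] C) (hex : Function.Exact i q)
    (F : Submodule R D) (hdisj : Disjoint (LinearMap.range i) F) (hF : F.map q = ⊤) :
    Function.Bijective (q.domRestrict F) := by
  constructor
  · rw [injective_iff_map_eq_zero]
    intro f hf
    rw [LinearMap.domRestrict_apply] at hf
    obtain ⟨a, ha⟩ := (hex (f : D)).mp hf
    have hmem : (f : D) ∈ LinearMap.range i ⊓ F := ⟨⟨a, ha⟩, f.2⟩
    rw [hdisj.eq_bot] at hmem
    exact Subtype.ext ((Submodule.mem_bot R).mp hmem)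
  · intro c
    have hc : c ∈ F.map q := hF ▸ Submodule.mem_top
    obtain ⟨f, hf, rfl⟩ := Submodule.mem_map.mp hc
    exact ⟨⟨f, hf⟩, rfl⟩

end Splitting

section Pairing

variable {R : Type*} [CommRing R]
variable {M : Type*} [AddCommGroup M] [Module R M]

/-- **The coordinate functional of a free complementary line.** If `M = L ⊕ R·ω` (an `IsCompl` of
submodules) and `ω` is free (`r • ω = 0 ⇒ r = 0`), there is `φ ∈ M^∨` with `φ|_L = 0` and `φ(ω) = 1`.
[cite: BurungaleSkinnerTianWan2024, Part I §5.3.2, TeX l.4174–4176 (the sentence «The restriction to D(T⁺) is mapped isomorphically onto 𝒪_λ» defining ω_{g,α} before (omega-g-eq)) — module-theoretic step F.4 of the in-cell reader repair «Lemma W» (D-AUDIT-cgs25-r1-ADDENDUM-2 §F) only; PREPRINT] -/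
theorem exists_dual_apply_eq_one_of_isCompl {L : Submodule R M} {ω : M} (h : IsCompl L (R ∙ ω))
    (hω : ∀ r : R, r • ω = 0 → r = 0) :
    ∃ φ : Module.Dual R M, (∀ l ∈ L, φ l = 0) ∧ φ ω = 1 := by
  have hinj : Function.Injective (LinearMap.toSpanSingleton R M ω) := by
    rw [injective_iff_map_eq_zero]
    intro r hr
    exact hω r (by simpa using hr)
  let e : R ≃ₗ[R] (R ∙ ω) :=
    (LinearEquiv.ofInjective _ hinj).trans
      (LinearEquiv.ofEq _ _ (LinearMap.range_toSpanSingleton ω))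
  have he1 : e 1 = ⟨ω, Submodule.mem_span_singleton_self ω⟩ := by
    apply Subtype.ext
    change ((LinearEquiv.ofInjective _ hinj 1 : LinearMap.range (LinearMap.toSpanSingleton R M ω)) : M)
      = ω
    rw [LinearEquiv.ofInjective_apply, LinearMap.toSpanSingleton_apply_one]
  refine ⟨(e.symm : (R ∙ ω) →ₗ[R] R) ∘ₗ Submodule.projectionOnto (R ∙ ω) L h.symm, ?_, ?_⟩
  · intro l hl
    rw [LinearMap.comp_apply, Submodule.projectionOnto_apply_of_mem_right h.symm hl, map_zero]
  · rw [LinearMap.comp_apply,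
      Submodule.projectionOnto_apply_of_mem_left h.symm (Submodule.mem_span_singleton_self ω), ← he1]
    exact e.symm_apply_apply 1

/-- **A split unimodular vector pairs onto the ring (core lemma).** `B` an ALTERNATING pairing on `M` whose
left map `M → M^∨` is surjective; `M = L + R·ω`; some functional takes the value `1` on `ω`. Then some
`t ∈ L` has `B(ω, t) = 1`. Proof: `B(v, −) = φ`, `v = l + rω`, `1 = φ(ω) = B(l, ω) = −B(ω, l)`.
In «Lemma W» (F.5): `B = D(e_{E•})` perfect alternating on `𝔻 = D(T⁺) ⊕ ℤ_pω_{E•}` gives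
`D(e_{E•})(ω_{E•}, D(T⁺)) = ℤ_p`. [cite: BurungaleSkinnerTianWan2024, Part I §5.3.2, TeX l.4174–4176 (the sentence «The restriction to D(T⁺) is mapped isomorphically onto 𝒪_λ» defining ω_{g,α} before (omega-g-eq)) — module-theoretic step F.5 of the in-cell reader repair «Lemma W» (D-AUDIT-cgs25-r1-ADDENDUM-2 §F) only; PREPRINT] -/
theorem exists_mem_apply_eq_one_of_isAlt (B : M →ₗ[R] M →ₗ[R] R) (hB : B.IsAlt)
    (hsurj : Function.Surjective B) {L : Submodule R M} {ω : M} (hsup : L ⊔ (R ∙ ω) = ⊤)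
    (hω : ∃ φ : Module.Dual R M, φ ω = 1) :
    ∃ t ∈ L, B ω t = 1 := by
  obtain ⟨φ, hφ⟩ := hω
  obtain ⟨v, hv⟩ := hsurj φ
  have hvtop : v ∈ L ⊔ (R ∙ ω) := hsup ▸ Submodule.mem_top
  obtain ⟨l, hl, z, hz, rfl⟩ := Submodule.mem_sup.mp hvtop
  obtain ⟨r, rfl⟩ := Submodule.mem_span_singleton.mp hz
  have h1 : B (l + r • ω) ω = 1 := by rw [hv]; exact hφ
  have h2 : B l ω = 1 := by
    rw [map_add, LinearMap.add_apply, map_smul, LinearMap.smul_apply, hB ω, smul_zero, add_zero] at h1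
    exact h1
  refine ⟨-l, L.neg_mem hl, ?_⟩
  rw [map_neg, ← hB.neg l ω, neg_neg, h2]

/-- Left/right-swapped form of `exists_mem_apply_eq_one_of_isAlt`: some `t ∈ L` has `B(t, ω) = 1`.
[cite: BurungaleSkinnerTianWan2024, Part I §5.3.2, TeX l.4174–4176 (the sentence «The restriction to D(T⁺) is mapped isomorphically onto 𝒪_λ» defining ω_{g,α} before (omega-g-eq)) — module-theoretic step F.5 of the in-cell reader repair «Lemma W» (D-AUDIT-cgs25-r1-ADDENDUM-2 §F) only; PREPRINT] -/
theorem exists_mem_apply_eq_one_of_isAlt' (B : M →ₗ[R] M →ₗ[R] R) (hB : B.IsAlt)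
    (hsurj : Function.Surjective B) {L : Submodule R M} {ω : M} (hsup : L ⊔ (R ∙ ω) = ⊤)
    (hω : ∃ φ : Module.Dual R M, φ ω = 1) :
    ∃ t ∈ L, B t ω = 1 := by
  obtain ⟨t, ht, h1⟩ := exists_mem_apply_eq_one_of_isAlt B hB hsurj hsup hω
  refine ⟨-t, L.neg_mem ht, ?_⟩
  rw [map_neg, LinearMap.neg_apply, hB.neg, h1]

/-- Ideal form: `B(ω, L) = R`, i.e. the image of `L` under `B(ω, −)` is the unit ideal. [cite: BurungaleSkinnerTianWan2024, Part I §5.3.2, TeX l.4174–4176 (the sentence «The restriction to D(T⁺) is mapped isomorphically onto 𝒪_λ» defining ω_{g,α} before (omega-g-eq)) — module-theoretic step F.5 of the in-cell reader repair «Lemma W» (D-AUDIT-cgs25-r1-ADDENDUM-2 §F) only; PREPRINT] -/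
theorem map_eq_top_of_isAlt (B : M →ₗ[R] M →ₗ[R] R) (hB : B.IsAlt)
    (hsurj : Function.Surjective B) {L : Submodule R M} {ω : M} (hsup : L ⊔ (R ∙ ω) = ⊤)
    (hω : ∃ φ : Module.Dual R M, φ ω = 1) :
    L.map (B ω) = ⊤ := by
  obtain ⟨t, ht, h1⟩ := exists_mem_apply_eq_one_of_isAlt B hB hsurj hsup hω
  exact Ideal.eq_top_of_isUnit_mem _ (Submodule.mem_map_of_mem ht) (h1 ▸ isUnit_one)

/-- Sanity of the hypotheses: a functional with `φ|_L = 0`, `φ(ω) = 1` forces `L ∩ R·ω = 0` and `ω` free —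
so together with `L + R·ω = M` the data of `exists_mem_apply_eq_one_of_isAlt` (with such a `φ`) is exactly an
internal direct sum `M = L ⊕ Rω` with `Rω ≅ R`. [cite: BurungaleSkinnerTianWan2024, Part I §5.3.2, TeX l.4174–4176 (the sentence «The restriction to D(T⁺) is mapped isomorphically onto 𝒪_λ» defining ω_{g,α} before (omega-g-eq)) — module-theoretic step F.5 of the in-cell reader repair «Lemma W» (D-AUDIT-cgs25-r1-ADDENDUM-2 §F) only; PREPRINT] -/
theorem eq_zero_of_smul_mem_of_dual {L : Submodule R M} {ω : M} (φ : Module.Dual R M)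
    (hφL : ∀ l ∈ L, φ l = 0) (hφω : φ ω = 1) (r : R) (hr : r • ω ∈ L) : r = 0 := by
  have h := hφL _ hr
  rwa [map_smul, hφω, smul_eq_mul, mul_one] at h

/-- **Rank-two basis form (the hyperbolic plane).** For an alternating pairing with surjective left map on a
module with a two-element basis `(b₀, b₁)`, the Gram entry `B(b₁, b₀)` is a unit (and `B(b₀, b₀) = B(b₁, b₁) = 0`).
In «Lemma W»: `𝔻` is free of rank `2` with basis `(u⁺, ω_{E•})`, `u⁺` a generator of `D(T⁺)`, so
`D(e_{E•})(ω_{E•}, u⁺) ∈ ℤ_p^×` and `η_{ω} := D(e)(ω_{E•}, u⁺)⁻¹ u⁺` generates `D(T⁺)` (F.5/F.6). [cite: BurungaleSkinnerTianWan2024, Part I §5.3.2, TeX l.4174–4176 (the sentence «The restriction to D(T⁺) is mapped isomorphically onto 𝒪_λ» defining ω_{g,α} before (omega-g-eq)) — module-theoretic step F.5 of the in-cell reader repair «Lemma W» (D-AUDIT-cgs25-r1-ADDENDUM-2 §F) only; PREPRINT] -/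
theorem isUnit_apply_basis_of_isAlt (B : M →ₗ[R] M →ₗ[R] R) (hB : B.IsAlt)
    (hsurj : Function.Surjective B) (b : Module.Basis (Fin 2) R M) : IsUnit (B (b 1) (b 0)) := by
  have hsup : (R ∙ b 0) ⊔ (R ∙ b 1) = ⊤ := by
    rw [Submodule.eq_top_iff']
    intro x
    rw [← b.sum_repr x, Fin.sum_univ_two]
    exact Submodule.add_mem_sup (Submodule.smul_mem _ _ (Submodule.mem_span_singleton_self _))
      (Submodule.smul_mem _ _ (Submodule.mem_span_singleton_self _))
  have hω : ∃ φ : Module.Dual R M, φ (b 1) = 1 :=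
    ⟨b.coord 1, by rw [Module.Basis.coord_apply, b.repr_self, Finsupp.single_eq_same]⟩
  obtain ⟨t, ht, h1⟩ := exists_mem_apply_eq_one_of_isAlt B hB hsurj hsup hω
  obtain ⟨c, rfl⟩ := Submodule.mem_span_singleton.mp ht
  rw [map_smul, smul_eq_mul] at h1
  exact IsUnit.of_mul_eq_one_right c h1

/-- `IsPerfPair` form of the core lemma: for a PERFECT alternating pairing, a split unimodular `ω` pairs onto
`R` with the complement `L`. [cite: BurungaleSkinnerTianWan2024, Part I §5.3.2, TeX l.4174–4176 (the sentence «The restriction to D(T⁺) is mapped isomorphically onto 𝒪_λ» defining ω_{g,α} before (omega-g-eq)) — module-theoretic step F.5 of the in-cell reader repair «Lemma W» (D-AUDIT-cgs25-r1-ADDENDUM-2 §F) only; PREPRINT] -/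
theorem exists_mem_apply_eq_one_of_isPerfPair (B : M →ₗ[R] M →ₗ[R] R) [B.IsPerfPair] (hB : B.IsAlt)
    {L : Submodule R M} {ω : M} (hsup : L ⊔ (R ∙ ω) = ⊤) (hω : ∃ φ : Module.Dual R M, φ ω = 1) :
    ∃ t ∈ L, B ω t = 1 :=
  exists_mem_apply_eq_one_of_isAlt B hB (LinearMap.IsPerfPair.bijective_left (p := B)).2 hsup hω

/-- `IsPerfPair` + basis form: a perfect alternating pairing on a free module of rank `2` is a hyperbolic
plane — `B(b₁, b₀)` is a unit for every basis `(b₀, b₁)`. [cite: BurungaleSkinnerTianWan2024, Part I §5.3.2, TeX l.4174–4176 (the sentence «The restriction to D(T⁺) is mapped isomorphically onto 𝒪_λ» defining ω_{g,α} before (omega-g-eq)) — module-theoretic step F.5 of the in-cell reader repair «Lemma W» (D-AUDIT-cgs25-r1-ADDENDUM-2 §F) only; PREPRINT] -/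
theorem isUnit_apply_basis_of_isPerfPair (B : M →ₗ[R] M →ₗ[R] R) [B.IsPerfPair] (hB : B.IsAlt)
    (b : Module.Basis (Fin 2) R M) : IsUnit (B (b 1) (b 0)) :=
  isUnit_apply_basis_of_isAlt B hB (LinearMap.IsPerfPair.bijective_left (p := B)).2 b

end Pairing

section Assembly

variable {R : Type*} [CommRing R]
variable {A D C : Type*} [AddCommGroup A] [Module R A] [AddCommGroup D] [Module R D]
  [AddCommGroup C] [Module R C]

/-- **«Lemma W», algebraic skeleton (F.4 + F.5 assembled).** Let `A —i→ D —q→ C` be exact at `D`; let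
`ω ∈ D` be free with `R·ω ∩ im i = 0` and `q(R·ω) = C` (so `D = im i ⊕ R·ω`, `isCompl_range_of_exact`); let
`B` be an alternating pairing on `D` with surjective left map. Then some `t ∈ im i` has `B(ω, t) = 1`, i.e.
`B(ω, im i) = R`. Dictionary (application, on paper): `i = D_λ(T⁺ ↪ T)`, `q = D_λ(T ↠ T⁻)`, `ω = ω_{E•}`
spanning `Fil¹`, `B = D(e_{E•})`; conclusion `D(e_{E•})(ω_{E•}, D(T⁺)) = ℤ_p`, whence BSTW l.4175–4176 for
Eisenstein `g` after the unit bookkeeping of F.2/F.3/F.6. [cite: BurungaleSkinnerTianWan2024, Part I §5.3.2, TeX l.4174–4176 (the sentence «The restriction to D(T⁺) is mapped isomorphically onto 𝒪_λ» defining ω_{g,α} before (omega-g-eq)) — module-theoretic steps F.4 + F.5 of the in-cell reader repair «Lemma W» (D-AUDIT-cgs25-r1-ADDENDUM-2 §F) only; PREPRINT] -/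
theorem exists_mem_range_apply_eq_one_of_exact_of_isAlt (i : A →ₗ[R] D) (q : D →ₗ[R] C)
    (hex : Function.Exact i q) {ω : D} (hdisj : Disjoint (LinearMap.range i) (R ∙ ω))
    (hq : (R ∙ ω).map q = ⊤) (hω : ∀ r : R, r • ω = 0 → r = 0)
    (B : D →ₗ[R] D →ₗ[R] R) (hB : B.IsAlt) (hsurj : Function.Surjective B) :
    ∃ t ∈ LinearMap.range i, B ω t = 1 := by
  have hc : IsCompl (LinearMap.range i) (R ∙ ω) := isCompl_range_of_exact i q hex _ hdisj hq
  obtain ⟨φ, -, hφ⟩ := exists_dual_apply_eq_one_of_isCompl hc hω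
  exact exists_mem_apply_eq_one_of_isAlt B hB hsurj (codisjoint_iff.mp hc.codisjoint) ⟨φ, hφ⟩

end Assembly

end Literature.LinearAlgebra.Alternating
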